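import Mathlib
import Literature.MathematicalPhysics.StatisticalMechanics.LennardJonesClusters

/-!
# Packing bound and site-energy floor for near-Barlow (`a/2`-separated) patches

Helper file for the stub `stub_nearPricingEngine` (N3) of the line `near-far-split` of the crux
`PricedLinkCensus.TruncatedCensusGap` (item stmt-AtomisticToContinuum-14230), skeleton
`Cruxes/TruncatedCensusGap/Lines/near_far_split.lean`.

The near-Barlow predicate of that skeleton carries the SEPARATION CLAUSE
`∀ j k, j ≠ k → dist (y j) (y i) ≤ 3a → a/2 ≤ dist (y j) (y k)`: every site of the closed
`3a`-patch of `y i` is at distance `≥ a/2` from every other site.  Two consequences used by the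
pricing engine's bookkeeping (uniform bounds on the number of interacting neighbours of a near
site and on its site energy):

* `card_filter_dist_le_of_patchSeparated` — **packing**: for `0 ≤ r ≤ 3a` the sites within `r`
  of `y i` number at most `(4r/a + 1)³` (volumes of the disjoint `a/4`-balls, the tree's
  `card_le_of_separated_of_dist_le`);
* `siteEnergy_truncLJ_ge_of_patchSeparated` — **site-energy floor**: for `a ≥ 2/3` (so that the
  range `2` of `V_χ(r) = min(1, max(0, 4 − 2r)) · V_LJ(r)` fits in the `3a`-patch) the site
  energy `∑_{k ≠ i} V_χ(|y_i − y_k|)` is `≥ −((8/a + 1)³ − 1)/12` (`V_χ ≥ −1/12`, `V_χ = 0`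
  beyond `2`), hence `≥ −74` on the near window `a ≥ 93/100`
  (`siteEnergy_truncLJ_ge_of_patchSeparated_window`);
* `nearBarlow_packing` — the registered one-line form (counts as `Nat.card`).
-/

noncomputable section

namespace Summit.AtomisticToContinuum.Crystallization.Theorems.PricedLinkCensusTruncatedCensusGap

open scoped BigOperators Classical
open Literature.MathematicalPhysics.StatisticalMechanics Module

/-- **Packing in a separated patch.** If every site within `3a` of `y i` is at distance `≥ a/2`
from every other site (`0 < a`), then for `0 ≤ r ≤ 3a` the sites within `r` of `y i` number at
most `(4r/a + 1)³`: they are distinct points, pairwise `≥ a/2` apart, in the ball of radius `r`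
(`card_le_of_separated_of_dist_le`). [folklore] -/
theorem card_filter_dist_le_of_patchSeparated {N : ℕ} (y : Fin N → EuclideanSpace ℝ (Fin 3))
    (i : Fin N) {a r : ℝ} (ha : 0 < a) (hr : 0 ≤ r) (hr3 : r ≤ 3 * a)
    (hsep : ∀ j k : Fin N, j ≠ k → dist (y j) (y i) ≤ 3 * a → a / 2 ≤ dist (y j) (y k)) :
    ((Finset.univ.filter fun j : Fin N => dist (y j) (y i) ≤ r).card : ℝ) ≤ (4 * r / a + 1) ^ 3 := by
  set S := Finset.univ.filter fun j : Fin N => dist (y j) (y i) ≤ r with hS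
  have hmem : ∀ {j}, j ∈ S → dist (y j) (y i) ≤ r := fun hj => (Finset.mem_filter.1 hj).2
  have hinj : Set.InjOn y S := fun j hj k _ hjk => by
    by_contra hne
    have h1 := hsep j k hne ((hmem hj).trans hr3)
    rw [hjk, dist_self] at h1
    linarith
  have h := card_le_of_separated_of_dist_le (S.image y) (y i) (half_pos ha) hr ?_ ?_
  · rw [finrank_euclideanSpace_fin, Finset.card_image_of_injOn hinj] at h
    have e : 2 * r / (a / 2) + 1 = 4 * r / a + 1 := by
      field_simp
      ring
    rwa [e] at h
  · simp only [Finset.mem_image]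
    rintro _ ⟨j, hj, rfl⟩
    exact hmem hj
  · simp only [Finset.mem_image]
    rintro _ ⟨j, hj, rfl⟩ _ ⟨k, _, rfl⟩ hjk
    exact hsep j k (fun h => hjk (by rw [h])) ((hmem hj).trans hr3)

/-- **The whole `3a`-patch has at most `13³ = 2197` sites.** [folklore] -/
theorem card_patch_le_of_patchSeparated {N : ℕ} (y : Fin N → EuclideanSpace ℝ (Fin 3))
    (i : Fin N) {a : ℝ} (ha : 0 < a)
    (hsep : ∀ j k : Fin N, j ≠ k → dist (y j) (y i) ≤ 3 * a → a / 2 ≤ dist (y j) (y k)) :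
    ((Finset.univ.filter fun j : Fin N => dist (y j) (y i) ≤ 3 * a).card : ℝ) ≤ 2197 := by
  have h := card_filter_dist_le_of_patchSeparated y i ha (by positivity) le_rfl hsep
  have e : (4 * (3 * a) / a + 1 : ℝ) = 13 := by
    field_simp
    ring
  rw [e] at h
  norm_num at h
  exact_mod_cast h

/-- **Sites within the interaction range.** For `2 ≤ 3a` the sites within distance `2` of `y i`
number at most `(8/a + 1)³`. [folklore] -/
theorem card_filter_dist_le_two_of_patchSeparated {N : ℕ} (y : Fin N → EuclideanSpace ℝ (Fin 3))
    (i : Fin N) {a : ℝ} (ha : 2 / 3 ≤ a)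
    (hsep : ∀ j k : Fin N, j ≠ k → dist (y j) (y i) ≤ 3 * a → a / 2 ≤ dist (y j) (y k)) :
    ((Finset.univ.filter fun j : Fin N => dist (y j) (y i) ≤ 2).card : ℝ) ≤ (8 / a + 1) ^ 3 := by
  have h := card_filter_dist_le_of_patchSeparated y i (by linarith) zero_le_two (by linarith) hsep
  have e : (4 * 2 / a + 1 : ℝ) = 8 / a + 1 := by ring
  rwa [e] at h

/-- **Site-energy floor of a separated patch.** With `V_χ(r) = min(1, max(0, 4 − 2r)) · V_LJ(r)`
(`≥ −1/12` everywhere, `= 0` for `r ≥ 2`) and `2/3 ≤ a`, the site energy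
`∑_{k ≠ i} V_χ(|y_i − y_k|)` of the centre of an `a/2`-separated `3a`-patch is at least
`−((8/a + 1)³ − 1)/12`: only the (at most `(8/a+1)³ − 1`) other sites within `2` contribute, each
at least `−1/12`. [folklore] -/
theorem siteEnergy_truncLJ_ge_of_patchSeparated {N : ℕ} (y : Fin N → EuclideanSpace ℝ (Fin 3))
    (i : Fin N) {a : ℝ} (ha : 2 / 3 ≤ a)
    (hsep : ∀ j k : Fin N, j ≠ k → dist (y j) (y i) ≤ 3 * a → a / 2 ≤ dist (y j) (y k)) :
    -(1 / 12) * ((8 / a + 1) ^ 3 - 1) ≤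
      siteEnergy (fun r => min 1 (max 0 (4 - 2 * r)) * lennardJones r) y i := by
  set B := Finset.univ.filter fun j : Fin N => dist (y j) (y i) ≤ 2 with hB
  have hcard : (B.card : ℝ) ≤ (8 / a + 1) ^ 3 := card_filter_dist_le_two_of_patchSeparated y i ha hsep
  -- pointwise floor: `-1/12` inside the range, `0` outside
  have hpt : ∀ k ∈ Finset.univ.erase i,
      (if k ∈ B then -(1 / 12 : ℝ) else 0) ≤
        min 1 (max 0 (4 - 2 * dist (y i) (y k))) * lennardJones (dist (y i) (y k)) := by
    intro k _
    split_ifs with hk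
    · have h0 : 0 ≤ min 1 (max 0 (4 - 2 * dist (y i) (y k))) :=
        le_min zero_le_one (le_max_left _ _)
      have h1 : min 1 (max 0 (4 - 2 * dist (y i) (y k))) ≤ 1 := min_le_left _ _
      nlinarith [mul_nonneg h0 (by linarith [neg_one_div_le_lennardJones (dist (y i) (y k))] :
        0 ≤ lennardJones (dist (y i) (y k)) + 1 / 12)]
    · have hk2 : 2 ≤ dist (y i) (y k) := by
        rw [dist_comm]
        by_contra hlt
        exact hk (Finset.mem_filter.2 ⟨Finset.mem_univ _, le_of_lt (not_le.1 hlt)⟩)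
      rw [max_eq_left (by linarith : 4 - 2 * dist (y i) (y k) ≤ 0), min_eq_right zero_le_one,
        zero_mul]
  have hsum := Finset.sum_le_sum hpt
  have hiB : i ∈ B := Finset.mem_filter.2 ⟨Finset.mem_univ _, by simp⟩
  have hL : ∑ k ∈ Finset.univ.erase i, (if k ∈ B then -(1 / 12 : ℝ) else 0) =
      -(1 / 12) * (B.card - 1) := by
    rw [Finset.sum_ite_mem, Finset.sum_const, nsmul_eq_mul]
    have hIB : Finset.univ.erase i ∩ B = B.erase i := by
      ext k
      simp [Finset.mem_erase]
    rw [hIB, Finset.card_erase_of_mem hiB, Nat.cast_sub (Finset.card_pos.2 ⟨i, hiB⟩)]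
    push_cast
    ring
  rw [hL] at hsum
  unfold siteEnergy
  refine le_trans ?_ hsum
  nlinarith

/-- **Site-energy floor on the near window**: for `a ≥ 93/100` the centre of an `a/2`-separated
`3a`-patch has `V_χ` site energy `≥ −74` (`((8/0.93 + 1)³ − 1)/12 ≈ 73.7`). [folklore] -/
theorem siteEnergy_truncLJ_ge_of_patchSeparated_window {N : ℕ}
    (y : Fin N → EuclideanSpace ℝ (Fin 3)) (i : Fin N) {a : ℝ} (ha : 93 / 100 ≤ a)
    (hsep : ∀ j k : Fin N, j ≠ k → dist (y j) (y i) ≤ 3 * a → a / 2 ≤ dist (y j) (y k)) :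
    -74 ≤ siteEnergy (fun r => min 1 (max 0 (4 - 2 * r)) * lennardJones r) y i := by
  have h := siteEnergy_truncLJ_ge_of_patchSeparated y i (by linarith) hsep
  have ha0 : 0 < a := by linarith
  have h8 : 8 / a + 1 ≤ 893 / 93 := by
    rw [div_add_one ha0.ne', div_le_div_iff₀ ha0 (by norm_num)]
    nlinarith
  have h8' : 0 ≤ 8 / a + 1 := by positivity
  have hcube : (8 / a + 1) ^ 3 ≤ (893 / 93 : ℝ) ^ 3 := pow_le_pow_left₀ h8' h8 3
  nlinarith

/-- **Near-Barlow packing (registered form).** On the near window `a ≥ 93/100`, the separation clause of the near-Barlow predicate alone gives: for `0 ≤ r ≤ 3a` at most `(4r/a + 1)³` sites within `r` of `y i`, and `V_χ` site energy `≥ −74` at `i`. [folklore] -/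
theorem nearBarlow_packing : ∀ (N : ℕ) (y : Fin N → EuclideanSpace ℝ (Fin 3)) (i : Fin N) (a : ℝ), 93 / 100 ≤ a → (∀ j k : Fin N, j ≠ k → dist (y j) (y i) ≤ 3 * a → a / 2 ≤ dist (y j) (y k)) → (∀ r : ℝ, 0 ≤ r → r ≤ 3 * a → (Nat.card {j : Fin N // dist (y j) (y i) ≤ r} : ℝ) ≤ (4 * r / a + 1) ^ 3) ∧ -74 ≤ Literature.MathematicalPhysics.StatisticalMechanics.siteEnergy (fun r => min 1 (max 0 (4 - 2 * r)) * Literature.MathematicalPhysics.StatisticalMechanics.lennardJones r) y i := by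
  intro N y i a ha hsep
  refine ⟨fun r hr hr3 => ?_, siteEnergy_truncLJ_ge_of_patchSeparated_window y i ha hsep⟩
  have h := card_filter_dist_le_of_patchSeparated y i (by linarith) hr hr3 hsep
  rwa [Nat.card_eq_fintype_card, Fintype.card_subtype]

end Summit.AtomisticToContinuum.Crystallization.Theorems.PricedLinkCensusTruncatedCensusGap

end
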